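import Mathlib
import HarnessLib

/-!
# Venture HSemireg — the trace anchor of the fibre test: translation classes are never
coboundaries and `vol ≠ 0` whenever `χ ≠ 0` (Hochschild–Koszul model, every `n`, every length)

HONEST FRAMING. Lean leaf for the computation cell `pub-hsemireg` (target seat t-5 gen 11; file of
record `run/shared/lean/pub/pub-hsemireg/target-g6/GRID-BARRIER-t5g9.md` §12.3 (F2) and §14.1,
2026-08-23). In the Hochschild–Koszul model of the fibre oracle (`hkfibre.py` / `hkcomplex.py`) a
finite-length module (or 0-dimensional complex) `M` over `k[x₁..x_n]` is a finite-dimensional space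
with `n` commuting operators `X_j`, the Ext algebra `Ext^•(M,M)` is the cohomology of
`End_k(M) ⊗ Λ(ξ₁..ξ_n)` with `d(φ ⊗ ω) = Σ_j [X_j, φ] ⊗ ξ_j ∧ ω`, the translation classes are
`τ_j = [Id ⊗ ξ_j]` and `vol = τ₁⋯τ_n = [Id ⊗ ξ₁⋯ξ_n]`. The note's (F2) «trace = length» says that
`Id ⊗ ξ_top` is not a coboundary: every top-degree coboundary has the form `Σ_j ±[X_j, φ_j] ⊗ ξ_top`,
and a sum of commutators has trace `0` while `tr Id = ℓ = length ≠ 0` (resp. the supertrace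
`= χ ≠ 0` for a complex). THIS FILE kernel-checks exactly that linear-algebra anchor, for matrices
of any size over any commutative ring in which the length is non-zero: a sum of commutators is
traceless (`trace_sum_commutator_eq_zero`), hence never the identity (`one_ne_sum_commutator`) nor
any `c • 1` with `c·ℓ ≠ 0`; in particular no single `φ` has `[X_j, φ] = 1`
(`commutator_ne_one`) — the translation class `τ_j` is never a coboundary. The identification of the
model with `Ext` (Cartan–Eilenberg IX §4) and everything else in §12–§14 of the note is NOT
formalised here. No object is constructed; nothing here bears on HC, HC_CM or HC_AV.
-/

namespace Summit.Ventures.HSemireg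

open Matrix

variable {R : Type*} [CommRing R] {m : Type*} [Fintype m] [DecidableEq m] {ι : Type*}

omit [DecidableEq m] in
/-- A commutator of square matrices is traceless. [folklore] -/
theorem trace_commutator_eq_zero (X φ : Matrix m m R) : trace (X * φ - φ * X) = 0 := by
  rw [trace_sub, trace_mul_comm, sub_self]

omit [DecidableEq m] in
/-- A finite sum of commutators `Σ_j (X_j φ_j − φ_j X_j)` is traceless. [folklore] -/
theorem trace_sum_commutator_eq_zero (s : Finset ι) (X φ : ι → Matrix m m R) :
    trace (∑ j ∈ s, (X j * φ j - φ j * X j)) = 0 := by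
  rw [trace_sum]
  exact Finset.sum_eq_zero fun j _ => trace_commutator_eq_zero (X j) (φ j)

/-- **(F2) anchor.** If the size `ℓ = |m|` of the matrices is non-zero in `R` (e.g. `R` a field of
characteristic `0` and `M ≠ 0`), then `c • 1` with `c·ℓ ≠ 0` is never a sum of commutators: in the
Hochschild–Koszul model the class `c·[Id ⊗ ξ_top]` is not a coboundary, i.e. `vol = τ₁⋯τ_n ≠ 0`
as soon as the (super)trace `χ` of the identity is non-zero. [folklore] -/
theorem smul_one_ne_sum_commutator (s : Finset ι) (X φ : ι → Matrix m m R) (c : R)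
    (hc : c * (Fintype.card m : R) ≠ 0) :
    c • (1 : Matrix m m R) ≠ ∑ j ∈ s, (X j * φ j - φ j * X j) := by
  intro h
  have ht := congrArg trace h
  rw [trace_sum_commutator_eq_zero, trace_smul, trace_one, smul_eq_mul] at ht
  exact hc ht

/-- The identity matrix is not a sum of commutators when `ℓ ≠ 0` in `R`. [folklore] -/
theorem one_ne_sum_commutator (s : Finset ι) (X φ : ι → Matrix m m R)
    (hl : (Fintype.card m : R) ≠ 0) :
    (1 : Matrix m m R) ≠ ∑ j ∈ s, (X j * φ j - φ j * X j) := by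
  have := smul_one_ne_sum_commutator s X φ 1 (by rwa [one_mul])
  rwa [one_smul] at this

/-- **The translation class `τ_j` is never a coboundary**: no `φ` satisfies `[X, φ] = 1` when
`ℓ ≠ 0` in `R` (the degree-1 instance: `Id ⊗ ξ_j = d(φ)` would need `[X_j, φ] = Id` and
`[X_i, φ] = 0` for `i ≠ j`; already the first equation is impossible). [folklore] -/
theorem commutator_ne_one (X φ : Matrix m m R) (hl : (Fintype.card m : R) ≠ 0) :
    X * φ - φ * X ≠ 1 := by
  intro h
  have ht := congrArg trace h
  rw [trace_commutator_eq_zero, trace_one] at ht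
  exact hl ht.symm

/-- Supertrace form for complexes: with a sign vector `ε` (the parity of the cohomological degree of
each basis vector) the «supertrace» `Σ_i ε_i A_ii` of a commutator of two EVEN (parity-preserving)
block matrices vanishes; stated here in the elementary form actually used by the engine — for
matrices commuting with the diagonal sign matrix `E = diag(ε)`, `tr(E·[X, φ]) = 0`. [folklore] -/
theorem trace_sign_mul_commutator_eq_zero (ε : m → R) (X φ : Matrix m m R)
    (hX : X * diagonal ε = diagonal ε * X) :
    trace (diagonal ε * (X * φ - φ * X)) = 0 := by
  rw [mul_sub, trace_sub, ← Matrix.mul_assoc, ← hX, Matrix.mul_assoc, trace_mul_comm X,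
    Matrix.mul_assoc, sub_self]

/-- Hence for a complex (identity of supertrace `χ = Σ ε_i ≠ 0`): `1` is not a sum of commutators
`[X_j, φ_j]` with even `X_j` (the `X_j` of a complex of modules preserve the grading). [folklore] -/
theorem one_ne_sum_even_commutator (s : Finset ι) (ε : m → R) (X φ : ι → Matrix m m R)
    (hX : ∀ j ∈ s, X j * diagonal ε = diagonal ε * X j) (hχ : ∑ i, ε i ≠ 0) :
    (1 : Matrix m m R) ≠ ∑ j ∈ s, (X j * φ j - φ j * X j) := by
  intro h
  have ht := congrArg (fun A => trace (diagonal ε * A)) h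
  simp only [Matrix.mul_one, trace_diagonal, Finset.mul_sum, trace_sum] at ht
  rw [Finset.sum_eq_zero fun j hj => trace_sign_mul_commutator_eq_zero ε (X j) (φ j) (hX j hj)] at ht
  exact hχ ht

/-- Odd case: for `δ`, `ψ` ODD with respect to the sign matrix (`δE = −Eδ`, `ψE = −Eψ`, e.g. the
strict differential of a complex and an odd cochain) the graded commutator `δψ + ψδ` has zero
supertrace: `tr(E(δψ + ψδ)) = 0`. [folklore] -/
theorem trace_sign_mul_anticommutator_eq_zero (ε : m → R) (δ ψ : Matrix m m R)
    (hδ : δ * diagonal ε = -(diagonal ε * δ)) :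
    trace (diagonal ε * (δ * ψ + ψ * δ)) = 0 := by
  have h1 : trace (diagonal ε * (ψ * δ)) = trace (δ * diagonal ε * ψ) := by
    rw [← Matrix.mul_assoc, trace_mul_comm, ← Matrix.mul_assoc]
  have h2 : trace (diagonal ε * (δ * ψ)) = trace (diagonal ε * δ * ψ) := by
    rw [Matrix.mul_assoc]
  rw [mul_add, trace_add, h1, h2, hδ, Matrix.neg_mul, trace_neg, add_neg_cancel]

/-- **(F2) anchor for complexes, full form.** In the twisted Hochschild–Koszul model the top-degree
coboundaries are sums of EVEN commutators `[X_j, φ_j]` (the `X_j` preserve the cohomological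
grading) and of graded commutators `δψ + ψδ` of ODD pairs (strict differentials); if the supertrace
`χ = Σ ε_i` of the identity is non-zero in `R`, the identity is not of this form — `vol ≠ 0`
whenever `χ(F) ≠ 0`. [folklore] -/
theorem one_ne_sum_graded_commutator (s : Finset ι) {κ : Type*} (t : Finset κ) (ε : m → R)
    (X φ : ι → Matrix m m R) (δ ψ : κ → Matrix m m R)
    (hX : ∀ j ∈ s, X j * diagonal ε = diagonal ε * X j)
    (hδ : ∀ k ∈ t, δ k * diagonal ε = -(diagonal ε * δ k)) (hχ : ∑ i, ε i ≠ 0) :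
    (1 : Matrix m m R) ≠
      ∑ j ∈ s, (X j * φ j - φ j * X j) + ∑ k ∈ t, (δ k * ψ k + ψ k * δ k) := by
  intro h
  have ht := congrArg (fun A => trace (diagonal ε * A)) h
  simp only [Matrix.mul_one, trace_diagonal, Matrix.mul_add, trace_add, Finset.mul_sum,
    trace_sum] at ht
  have hs : ∑ j ∈ s, trace (diagonal ε * (X j * φ j - φ j * X j)) = 0 :=
    Finset.sum_eq_zero fun j hj => trace_sign_mul_commutator_eq_zero ε (X j) (φ j) (hX j hj)
  have ht' : ∑ k ∈ t, (trace (diagonal ε * (δ k * ψ k)) + trace (diagonal ε * (ψ k * δ k))) = 0 := by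
    refine Finset.sum_eq_zero fun k hk => ?_
    have := trace_sign_mul_anticommutator_eq_zero ε (δ k) (ψ k) (hδ k hk)
    rwa [mul_add, trace_add] at this
  rw [hs, ht', zero_add] at ht
  exact hχ ht

end Summit.Ventures.HSemireg
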